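import Summits.Parity.GeneralizedHardyLittlewood.Theorems.PrimeLevelFamEdgeMomentsBeyondDiagonalRefutationShapes
import HarnessLib

/-!
# Route `PrimeLevelFamEdge`, crux K_A `MomentsBeyondDiagonal` (stmt-Parity-20007), line «petersson_layers» v3:
# MODULO THE OTHER REGISTERED STUBS, EACH EXPLICIT PIECE IS EQUIVALENT TO THE CRUX (lead prover, 2026-08-28)

The registered line cuts `Q^h(P,Q)(q̂^{Δ'})` into the diagonal part `D`, the rung `K₁`, the core layers
`2 ≤ r ≤ q̂^{ρ_c}`, the generic band `q̂^{ρ_c} < r ≤ q̂^{ρ_P}`, and the far layers `r > q̂^{ρ_P}` (via the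
difference-defined tail and the identification `TailNearFar ρ_P`), and asks EACH piece to have the second-display
shape with its own level-free functional (seven stubs `stub_first … stub_farP`; composition
`MomentsBeyondDiagonal_of_sevenSplitBands`). This file proves the CONVERSE bookkeeping the line card states in
words («`stub_core` = THE CRUX PROPER»), and a little more:

* §1 glue: `SubOf` is closed under differences (`subOf_of_sub`); K_A gives the shape of the undivided second
  moment (`subOf_QhPQ_of_momentsBeyondDiagonal`); hence, given K_A, any two of {`SubDiag`, `SubHeart ρ`,
  `SubTail ρ`} give the third, any two of {`SubRung`, `SubUpper ρ`, `SubHeart ρ`} give the third, and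
  `TailNearFar ρ` turns `SubTail ρ` into `SubFar ρ`.
* §2 THE EQUIVALENCES. Assuming the other six registered stubs, EACH of `stub_diag`, `stub_rung`, `stub_core`,
  `stub_band`, `stub_farP` is EQUIVALENT to `MomentsBeyondDiagonal` (`subDiag_iff_momentsBeyondDiagonal`,
  `subRung_iff_…`, `subUpper_rhoCore_iff_…`, `subBand_iff_…`, `subFar_rhoP_iff_…`), and `stub_first` is implied
  by K_A outright (deck 15). So the line is K_A re-cut, not weakened: whichever explicit heart piece is proved
  LAST carries the whole remaining strength of K_A (in particular its ∀-in-q / (A)-sensitive burden); formally the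
  decomposition does not localise that burden in `stub_core` rather than `stub_rung` or `stub_band` — the card's
  size ledger (where the DIFFICULTY is expected) is a statement about mathematics, not about the registered
  shapes. The identification `stub_identP : TailNearFar ρ_P` is the one registered statement NOT recovered here
  from K_A and the others (it pins `t_tail = −t_far`, i.e. the content of AFE ∘ Hecke ∘ Petersson).
* §3 the coarsest cut: given `SubFirst` and `SubDiag`, K_A ⟺ `SubTail rhoEmpty` («the whole off-diagonal
  `Q^h − D` has the shape»).

HONESTY. Glue only: no stub is proved, no moment asymptotic and no exceptional-zero statement (no Landau–Siegel /
Siegel-zero exclusion, no GRH) is proved or claimed; famE-02 remains OPEN IN PRINT.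
-/

noncomputable section

open scoped Real
open Complex Polynomial
open Literature.NumberTheory.LFunctions

namespace Summit.Parity.GeneralizedHardyLittlewood.Theorems.PrimeLevelFamEdgeIdeaDeltas.PeterssonLayers

open Summit.Parity.GeneralizedHardyLittlewood.Theses.PrimeLevelFamEdge (MomentsBeyondDiagonal)
open Summit.Parity.GeneralizedHardyLittlewood.Theorems.PrimeLevelFamEdgeIdeaDeltas.PairsSplit (SubFirst)

/-! ## §1. Glue: differences, the undivided second moment, and the three-term identities read backwards -/

/-- **DIFFERENCE GLUE:** if `H = A − B` eventually (for `q ≥ 64`, on the window), then `SubOf A → SubOf B → SubOf H`. -/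
theorem subOf_of_sub (H A B : LevelFamily)
    (hsplit : ∀ (q : ℕ) [NeZero q] (P Q : ℝ[X]) (Δ' : ℝ), 1 < Δ' → 64 ≤ q →
      H q P Q Δ' = A q P Q Δ' - B q P Q Δ') :
    SubOf A → SubOf B → SubOf H :=
  fun hA hB ↦ subOf_of_add H A (fun q _ P Q Δ' ↦ -B q P Q Δ')
    (fun q _ P Q Δ' hΔ' hq ↦ by rw [hsplit q P Q Δ' hΔ' hq, sub_eq_add_neg]) hA (subOf_neg _ hB)

/-- **K_A gives the undivided second moment the shape** (functional `secondMomentForm + T₂`). -/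
theorem subOf_QhPQ_of_momentsBeyondDiagonal (h : MomentsBeyondDiagonal) :
    SubOf (fun q _ P Q Δ' ↦ KMV2000.QhPQ q P Q (KMV2000.qhat q ^ Δ')) := by
  obtain ⟨Δ, hΔ, T₁, T₂, H⟩ := h
  exact ⟨Δ, hΔ, _, hasShape_QhPQ_of_momentAsymptotics H⟩

/-- Given K_A: `SubDiag → SubHeart ρ → SubTail ρ` (`tail = (Q^h − D) + heart`). -/
theorem subTail_of_KA_diag_heart (ρ : ℝ → ℝ) (h : MomentsBeyondDiagonal) :
    SubDiag → SubHeart ρ → SubTail ρ := fun hD hH ↦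
  subOf_of_add (fun q _ P Q Δ' ↦ tail q ρ P Q Δ')
    (fun q _ P Q Δ' ↦ KMV2000.QhPQ q P Q (KMV2000.qhat q ^ Δ') - diagPart q P Q Δ')
    (fun q _ P Q Δ' ↦ heart q ρ P Q Δ') (fun _ _ _ _ _ _ _ ↦ rfl)
    (subOf_of_sub _ _ _ (fun _ _ _ _ _ _ _ ↦ rfl) (subOf_QhPQ_of_momentsBeyondDiagonal h) hD) hH

/-- Given K_A: `SubDiag → SubTail ρ → SubHeart ρ` (`heart = tail − (Q^h − D)`). -/
theorem subHeart_of_KA_diag_tail (ρ : ℝ → ℝ) (h : MomentsBeyondDiagonal) :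
    SubDiag → SubTail ρ → SubHeart ρ := fun hD hT ↦
  subOf_of_sub (fun q _ P Q Δ' ↦ heart q ρ P Q Δ') (fun q _ P Q Δ' ↦ tail q ρ P Q Δ')
    (fun q _ P Q Δ' ↦ KMV2000.QhPQ q P Q (KMV2000.qhat q ^ Δ') - diagPart q P Q Δ')
    (fun q _ P Q Δ' _ _ ↦ by unfold tail; ring) hT
    (subOf_of_sub _ _ _ (fun _ _ _ _ _ _ _ ↦ rfl) (subOf_QhPQ_of_momentsBeyondDiagonal h) hD)

/-- Given K_A: `SubHeart ρ → SubTail ρ → SubDiag` (`D = (Q^h + heart) − tail`). -/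
theorem subDiag_of_KA_heart_tail (ρ : ℝ → ℝ) (h : MomentsBeyondDiagonal) :
    SubHeart ρ → SubTail ρ → SubDiag := fun hH hT ↦
  subOf_of_sub (fun q _ P Q Δ' ↦ diagPart q P Q Δ')
    (fun q _ P Q Δ' ↦ KMV2000.QhPQ q P Q (KMV2000.qhat q ^ Δ') + heart q ρ P Q Δ')
    (fun q _ P Q Δ' ↦ tail q ρ P Q Δ')
    (fun q _ P Q Δ' _ _ ↦ by unfold tail; ring)
    (subOf_of_add _ _ _ (fun _ _ _ _ _ _ _ ↦ rfl) (subOf_QhPQ_of_momentsBeyondDiagonal h) hH) hT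

/-- `SubUpper ρ → SubHeart ρ → SubRung` for cuts `ρ ≥ 0` beyond the diagonal (`rung = heart − upper`). -/
theorem subRung_of_upper_heart (ρ : ℝ → ℝ) (hρ : ∀ Δ' : ℝ, 1 < Δ' → 0 ≤ ρ Δ') :
    SubUpper ρ → SubHeart ρ → SubRung := fun hU hH ↦
  subOf_of_sub (fun q _ P Q Δ' ↦ rung q P Q Δ') (fun q _ P Q Δ' ↦ heart q ρ P Q Δ')
    (fun q _ P Q Δ' ↦ upper q ρ P Q Δ')
    (fun q _ P Q Δ' hΔ' hq ↦ by
      rw [heart_eq_rung_add_upper q ρ P Q Δ' (one_le_layerCount hq (hρ Δ' hΔ'))]; ring) hH hU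

/-- `SubRung → SubHeart ρ → SubUpper ρ` for cuts `ρ ≥ 0` beyond the diagonal (`upper = heart − rung`). -/
theorem subUpper_of_rung_heart (ρ : ℝ → ℝ) (hρ : ∀ Δ' : ℝ, 1 < Δ' → 0 ≤ ρ Δ') :
    SubRung → SubHeart ρ → SubUpper ρ := fun hR hH ↦
  subOf_of_sub (fun q _ P Q Δ' ↦ upper q ρ P Q Δ') (fun q _ P Q Δ' ↦ heart q ρ P Q Δ')
    (fun q _ P Q Δ' ↦ rung q P Q Δ')
    (fun q _ P Q Δ' hΔ' hq ↦ by
      rw [heart_eq_rung_add_upper q ρ P Q Δ' (one_le_layerCount hq (hρ Δ' hΔ'))]; ring) hH hR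

/-- `SubUpper ρ₁ → SubUpper ρ₂ → SubBand ρ₁ ρ₂` for cuts `0 ≤ ρ₁ ≤ ρ₂` beyond the diagonal
(`band = upper ρ₂ − upper ρ₁`). -/
theorem subBand_of_uppers (ρ₁ ρ₂ : ℝ → ℝ) (h0 : ∀ Δ' : ℝ, 1 < Δ' → 0 ≤ ρ₁ Δ')
    (h12 : ∀ Δ' : ℝ, 1 < Δ' → ρ₁ Δ' ≤ ρ₂ Δ') :
    SubUpper ρ₁ → SubUpper ρ₂ → SubBand ρ₁ ρ₂ := fun h₁ h₂ ↦
  subOf_of_sub (fun q _ P Q Δ' ↦ band q ρ₁ ρ₂ P Q Δ') (fun q _ P Q Δ' ↦ upper q ρ₂ P Q Δ')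
    (fun q _ P Q Δ' ↦ upper q ρ₁ P Q Δ')
    (fun q _ P Q Δ' hΔ' hq ↦ by
      rw [upper_eq_upper_add_band q ρ₁ ρ₂ P Q Δ' (one_le_layerCount hq (h0 Δ' hΔ'))
        (layerCount_mono hq (h12 Δ' hΔ'))]; ring) h₂ h₁

/-- `SubUpper ρ₂ → SubBand ρ₁ ρ₂ → SubUpper ρ₁` for cuts `0 ≤ ρ₁ ≤ ρ₂` beyond the diagonal
(`upper ρ₁ = upper ρ₂ − band`). -/
theorem subUpper_of_upper_band' (ρ₁ ρ₂ : ℝ → ℝ) (h0 : ∀ Δ' : ℝ, 1 < Δ' → 0 ≤ ρ₁ Δ')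
    (h12 : ∀ Δ' : ℝ, 1 < Δ' → ρ₁ Δ' ≤ ρ₂ Δ') :
    SubUpper ρ₂ → SubBand ρ₁ ρ₂ → SubUpper ρ₁ := fun h₂ hB ↦
  subOf_of_sub (fun q _ P Q Δ' ↦ upper q ρ₁ P Q Δ') (fun q _ P Q Δ' ↦ upper q ρ₂ P Q Δ')
    (fun q _ P Q Δ' ↦ band q ρ₁ ρ₂ P Q Δ')
    (fun q _ P Q Δ' hΔ' hq ↦ by
      rw [upper_eq_upper_add_band q ρ₁ ρ₂ P Q Δ' (one_le_layerCount hq (h0 Δ' hΔ'))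
        (layerCount_mono hq (h12 Δ' hΔ'))]; ring) h₂ hB

/-- `TailNearFar ρ → SubTail ρ → SubFar ρ` (`far = −tail + (tail + far)`, the bracket is the identification error). -/
theorem subFar_of_ident_tail (ρ : ℝ → ℝ) : TailNearFar ρ → SubTail ρ → SubFar ρ := by
  rintro ⟨Δ₁, h₁, H⟩ hT
  have hnear : Near (fun q _ P Q Δ' ↦ farLayers q ρ P Q Δ') (fun q _ P Q Δ' ↦ -tail q ρ P Q Δ') := by
    refine ⟨Δ₁, h₁, fun P Q hP hQ Δ' hlo hhi ↦ ?_⟩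
    obtain ⟨C, q₀, HH⟩ := H P Q hP hQ Δ' hlo hhi
    refine ⟨C, q₀, fun q _ hq hq₀ hM ↦ ?_⟩
    have h := HH q hq hq₀ hM
    have e : farLayers q ρ P Q Δ' - -tail q ρ P Q Δ' = tail q ρ P Q Δ' - -farLayers q ρ P Q Δ' := by ring
    rw [e]
    exact h
  exact subOf_of_near _ _ hnear (subOf_neg _ hT)

/-! ## §2. Modulo the other six registered stubs, each explicit piece ⟺ K_A -/

/-- Given `SubRung`, `SubUpper ρ_c`, `SubBand ρ_c ρ_P`: the heart at the print cut, `SubHeart ρ_P`. -/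
theorem subHeart_rhoP_of_rung_core_band (h3 : SubRung) (h4 : SubUpper rhoCore) (h5 : SubBand rhoCore rhoP) :
    SubHeart rhoP :=
  subHeart_of_rung_upper rhoP (fun Δ' hΔ' ↦ rhoP_nonneg Δ' hΔ') h3
    (subUpper_of_upper_band rhoCore rhoP rhoCore_nonneg rhoCore_le_rhoP h4 h5)

/-- **`stub_core` ⟺ K_A modulo the other six stubs.** Given `SubFirst`, `SubDiag`, `SubRung`, `SubBand ρ_c ρ_P`,
`TailNearFar ρ_P`, `SubFar ρ_P`: the CORE piece `SubUpper rhoCore` holds iff `MomentsBeyondDiagonal` does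
(→ the registered composition; ← `upper ρ_c = ((tail ρ_P − (Q^h − D)) − rung) − band`). The card's «THE CRUX
PROPER», kernel-checked as an equivalence. -/
theorem subUpper_rhoCore_iff_momentsBeyondDiagonal (h1 : SubFirst) (h2 : SubDiag) (h3 : SubRung)
    (h5 : SubBand rhoCore rhoP) (h6 : TailNearFar rhoP) (h7 : SubFar rhoP) :
    SubUpper rhoCore ↔ MomentsBeyondDiagonal := by
  constructor
  · intro h4
    exact MomentsBeyondDiagonal_of_sevenSplitBands h1 h2 h3 h4 h5 h6 h7
  · intro h
    have hT : SubTail rhoP := subTail_of_ident_far rhoP h6 h7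
    have hH : SubHeart rhoP := subHeart_of_KA_diag_tail rhoP h h2 hT
    have hU : SubUpper rhoP := subUpper_of_rung_heart rhoP (fun Δ' hΔ' ↦ rhoP_nonneg Δ' hΔ') h3 hH
    exact subUpper_of_upper_band' rhoCore rhoP rhoCore_nonneg rhoCore_le_rhoP hU h5

/-- **`stub_rung` ⟺ K_A modulo the other six stubs** (← `rung = heart ρ_P − upper ρ_P`). -/
theorem subRung_iff_momentsBeyondDiagonal (h1 : SubFirst) (h2 : SubDiag) (h4 : SubUpper rhoCore)
    (h5 : SubBand rhoCore rhoP) (h6 : TailNearFar rhoP) (h7 : SubFar rhoP) :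
    SubRung ↔ MomentsBeyondDiagonal := by
  constructor
  · intro h3
    exact MomentsBeyondDiagonal_of_sevenSplitBands h1 h2 h3 h4 h5 h6 h7
  · intro h
    have hT : SubTail rhoP := subTail_of_ident_far rhoP h6 h7
    have hH : SubHeart rhoP := subHeart_of_KA_diag_tail rhoP h h2 hT
    have hU : SubUpper rhoP := subUpper_of_upper_band rhoCore rhoP rhoCore_nonneg rhoCore_le_rhoP h4 h5
    exact subRung_of_upper_heart rhoP (fun Δ' hΔ' ↦ rhoP_nonneg Δ' hΔ') hU hH

/-- **`stub_band` ⟺ K_A modulo the other six stubs** (← `band = (heart ρ_P − rung) − upper ρ_c`). -/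
theorem subBand_iff_momentsBeyondDiagonal (h1 : SubFirst) (h2 : SubDiag) (h3 : SubRung) (h4 : SubUpper rhoCore)
    (h6 : TailNearFar rhoP) (h7 : SubFar rhoP) :
    SubBand rhoCore rhoP ↔ MomentsBeyondDiagonal := by
  constructor
  · intro h5
    exact MomentsBeyondDiagonal_of_sevenSplitBands h1 h2 h3 h4 h5 h6 h7
  · intro h
    have hT : SubTail rhoP := subTail_of_ident_far rhoP h6 h7
    have hH : SubHeart rhoP := subHeart_of_KA_diag_tail rhoP h h2 hT
    have hU : SubUpper rhoP := subUpper_of_rung_heart rhoP (fun Δ' hΔ' ↦ rhoP_nonneg Δ' hΔ') h3 hH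
    exact subBand_of_uppers rhoCore rhoP rhoCore_nonneg rhoCore_le_rhoP h4 hU

/-- **`stub_diag` ⟺ K_A modulo the other six stubs** (← `D = (Q^h + heart ρ_P) − tail ρ_P`). -/
theorem subDiag_iff_momentsBeyondDiagonal (h1 : SubFirst) (h3 : SubRung) (h4 : SubUpper rhoCore)
    (h5 : SubBand rhoCore rhoP) (h6 : TailNearFar rhoP) (h7 : SubFar rhoP) :
    SubDiag ↔ MomentsBeyondDiagonal := by
  constructor
  · intro h2
    exact MomentsBeyondDiagonal_of_sevenSplitBands h1 h2 h3 h4 h5 h6 h7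
  · intro h
    exact subDiag_of_KA_heart_tail rhoP h (subHeart_rhoP_of_rung_core_band h3 h4 h5)
      (subTail_of_ident_far rhoP h6 h7)

/-- **`stub_farP` ⟺ K_A modulo the other six stubs** (← `far = −tail ρ_P +` identification error, with
`tail ρ_P = (Q^h − D) + heart ρ_P`). -/
theorem subFar_rhoP_iff_momentsBeyondDiagonal (h1 : SubFirst) (h2 : SubDiag) (h3 : SubRung)
    (h4 : SubUpper rhoCore) (h5 : SubBand rhoCore rhoP) (h6 : TailNearFar rhoP) :
    SubFar rhoP ↔ MomentsBeyondDiagonal := by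
  constructor
  · intro h7
    exact MomentsBeyondDiagonal_of_sevenSplitBands h1 h2 h3 h4 h5 h6 h7
  · intro h
    exact subFar_of_ident_tail rhoP h6
      (subTail_of_KA_diag_heart rhoP h h2 (subHeart_rhoP_of_rung_core_band h3 h4 h5))

/-- **`stub_first` ⟺ K_A modulo the other six stubs** (← is deck 15's `subFirst_of_KA`, from K_A alone). -/
theorem subFirst_iff_momentsBeyondDiagonal (h2 : SubDiag) (h3 : SubRung) (h4 : SubUpper rhoCore)
    (h5 : SubBand rhoCore rhoP) (h6 : TailNearFar rhoP) (h7 : SubFar rhoP) :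
    SubFirst ↔ MomentsBeyondDiagonal :=
  ⟨fun h1 ↦ MomentsBeyondDiagonal_of_sevenSplitBands h1 h2 h3 h4 h5 h6 h7, subFirst_of_KA⟩

/-! ## §3. The coarsest cut: DIAGONAL / OFF-DIAGONAL -/

/-- Given `SubFirst` and `SubDiag`, K_A ⟺ «the whole off-diagonal `Q^h − D` has the shape» (`SubTail rhoEmpty`). -/
theorem momentsBeyondDiagonal_iff_subTail_rhoEmpty (h1 : SubFirst) (h2 : SubDiag) :
    MomentsBeyondDiagonal ↔ SubTail rhoEmpty := by
  constructor
  · intro h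
    exact subTail_of_KA_diag_heart rhoEmpty h h2 subHeart_rhoEmpty
  · intro hT
    exact momentsBeyondDiagonal_of_diag_offDiag h1 h2 hT

end Summit.Parity.GeneralizedHardyLittlewood.Theorems.PrimeLevelFamEdgeIdeaDeltas.PeterssonLayers

end
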